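import Literature.MathematicalPhysics.QuantumFieldTheory.YangMillsOS
import HarnessLib

/-!
# The weak-coupling slice bottleneck of a lattice gauge theory (twist-sector input)

A precise `Prop` — NOT asserted — recording the input under which volume-uniform Poincaré
inequalities for gauge-invariant functions of the time-zero slice of Wilson's lattice gauge theory,
with respect to SINGLE-LINK Dirichlet forms, fail at weak coupling: `SliceBottleneckAt G r` says
that for cofinally many inverse couplings `β`, every polynomial-volume budget `K (2S+1)³` and
cofinally many torus sizes `S` there is a gauge-invariant, time-zero-local, link-Lipschitz test
function `f` on the torus `(ℤ/(2S+1))⁴` with `K (2S+1)³ · dir f < Var_μ f`, where `μ` is Wilson's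
measure, `Var_μ` the variance and `dir f = Σ_{ℓ spatial, t = 0} ∫ |∇_ℓ f|² dμ` the time-zero
metric-slope Dirichlet form (the vocabulary of the `QuantumFields/YangMills` functional-inequality
routes, verbatim). `SliceBottleneck` packages an admissible compact simple `G` (in the sense of
`IsCompactSimpleLieGroup`) and a faithful unitary `r` carrying it.

## Intended inhabitant (physics; why the fact is expected TRUE for `G = SO(3)`)

For a compact simple `G` with `π₁(G) ≠ 0` — `SO(3) = PSU(2)`, `PSU(N)`, `SO(N)`, all admitted by
`IsCompactSimpleLieGroup` — the time-zero slice (a `G`-lattice gauge field on the spatial 3-torus)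
carries the 't Hooft magnetic flux `m ∈ H²(T³; π₁(G))` ('t Hooft 1979): for `SO(3)`, lift the
links to `SU(2)`, read the plaquette signs `η_p = sgn tr_F Ũ_p` — on the lattice exactly
de Forcrand–Jahn's "proper `SO(3)` observable" `η_{μν}` (§4) — cancel the `ℤ₂`-monopole charges
(cubes with `∏ η = −1`; each has a far-from-identity face by the Bianchi identity, action `≥ c₀β`;
in 4d the monopole current forms closed loops, so the slice sees a dilute gas of tight neutral
pairs) inside the canonical scale-relative isolated neutral clusters, and take the class of the
resulting cocycle. Off a bad event `B_S` ("a cluster is non-neutral or of diameter `≍ S`") the class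
is (i) gauge invariant and a function of the time-zero spatial links only; (ii) locally constant in
the link metric `d(U,V) = Σ_e ‖ρ(U_e) − ρ(V_e)‖_F`, with distinct sectors at `d`-distance
`≥ δ₀ > 0` uniformly in `S`, so the distance-function interpolant
`f_S = d(·,A')/(d(·,A) + d(·,A'))` between two sectors is gauge invariant, time-zero-local,
`(3/δ₀)`-Lipschitz, with metric slopes supported in a slightly enlarged bad event `B'_S`;
(iii) `μ(B'_S) ≤ C S^{−p(β)}`, `p(β) → ∞` (multi-scale Peierls for the dilute monopole gas), so
`dir f_S = o(S^{−6})` for `β ≥ β₀`; (iv) the sector weights are non-degenerate on large tori —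
magnetic fluxes of a pure gauge theory are LIGHT: flat "twist-eating" connections carry magnetic
twist at zero action, and in the confined phase all classes become equiprobable as `S → ∞`
(twisted/untwisted partition-function ratios `→ 1`, de Forcrand–von Smekal 2002; all sectors
present in periodic `SO(3)` lattice gauge theory, disconnected as monopoles are suppressed for
`β → ∞`, and not changed by local updates on lattices beyond `4⁴`: de Forcrand–Jahn 2003, §§4, 6 —
the classical ergodicity obstruction of `SO(3)` simulations). Hence `Var f_S ≥ δ²` while
`K (2S+1)³ dir f_S → 0`. Input (iv) is physics (not proved for any non-abelian `G` in `d = 4`);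
(i)–(iii) are rigorous on paper, unformalised. For SIMPLY-CONNECTED `G` at weak coupling no such
sector exists (a non-trivial sign class costs a centre-vortex sheet, mass `e^{−cβS²}`).

## Use

Hypothesis `H` of negative lemmas `H → ¬ D` for slice-Poincaré route items `D` of
`Summits/QuantumFields/YangMills` (e.g. `ConvexGribovBody.BrascampLiebVacuum`, whose covariance
scale obeys the a-priori volume bound `Dmax ≤ 3N(2S+1)³`). Nothing here is asserted; inhabiting
`SliceBottleneck` is a construction item.

## Status (construction item `defn-…SliceBottleneck`, literature-prover verdict `open-problem`, 2026-08-16)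

`SliceBottleneck` is a hypothesis bundle minted by a refuter for a negative lemma and is proved in NO
source; it is registered here as an OPEN statement (`@[conjecture]`, `[status: open]`; statement
unchanged byte for byte, names kept because of the user
`Summits/QuantumFields/YangMills/Theorems/BrascampLiebVacuum/Negative/FalseOfSliceBottleneck.lean`);
there is deliberately no `SliceBottleneck_holds`. Why no witness is available. (1) No formalisation
artefact inhabits it: under the hypotheses of `SliceBottleneckAt` the variance and the Dirichlet form
are genuine (a link-Lipschitz `f` has difference quotients in `[0, K']`, so every `limsup` is a true
metric slope; `f` is continuous, hence measurable for the product Borel structure, `G` being second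
countable through `r`; Wilson's measure is a probability measure), and `K` ranges over all reals, so
the budget cannot be dodged. (2) An honest witness needs, at FIXED weak coupling `β` and `S → ∞`, a
gauge-invariant slow mode with `Var/dir ≫ S³`; volume averages of local observables give at most
`O(S³)` (susceptibility `≤ S³ ·` variance of the observable), so only exponentially good bottlenecks —
topological sectors for `π₁(G) ≠ 0` — can serve, and by the criterion below the missing input is then
exactly the pair of measure estimates (iii)–(iv) above; (iv), a lower bound on the Wilson mass of a
non-trivial 't Hooft flux sector of `SO(3)₄` uniform in the torus size at fixed large `β`
(`Z₋/Z₊ ↛ 0`, "light magnetic flux"), is open: what is PROVED is the Tomboulis–Yaffe inequality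
bounding Wilson loops by the electric-flux free energy, under which light magnetic flux
`F_mg ∼ L_z L_t e^{−ρ L_x L_y}` is a SUFFICIENT CONDITION for confinement, supported by Monte-Carlo
computations of `Z₋/Z₊` (Kovács–Tomboulis 2000; de Forcrand–von Smekal) but not proved
[cite: Greensite2020Confinement, §4.4 eqs. (4.44)–(4.47), PDF p. 47]; the one claimed proof for all `β`
(Tomboulis 2007, via potential-moving decimations bounding exactly this ratio of twisted to untwisted
partition functions) is disputed — "We point out missing links in the recent paper by Tomboulis in
which he claims a rigorous proof of quark confinement in 4D lattice gauge theory"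
[cite: ItoSeiler2007Tomboulis, abstract (p. 2)] [claim: Tomboulis2007Confinement, status: disputed].
(3) The negation `¬ SliceBottleneck` is a weak-coupling, volume-polynomial Poincaré inequality for the
time-zero law of EVERY compact simple `G` — the content of the crux it was minted against; open as well.
The eventual home of the statement is an `@[conjecture]` obligation under
`Summits/QuantumFields/YangMills/Theorems/` (planner's call: crux or `conditional_on`).

## Proved API: the two-set bottleneck criterion (companion file `SliceBottleneckCriterion.lean`)

`sliceBottleneckAt_of_separatedSets` — the easy direction of Cheeger's inequality in the vocabulary
of `SliceBottleneckAt`, fully proved there: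
if for cofinally many `β`, all budgets `K ≥ 0` and cofinally many `S` there are measurable events
`A`, `A'` of gauge fields on `(ℤ/(2S+1))⁴`, `A'` gauge invariant, separated on the time-zero slice
(`sliceDist r U V ≥ δ > 0` for `U ∈ A`, `V ∈ A'`, `sliceDist` = the items' link metric restricted to
time-zero spatial links) with `K (2S+1)³ · |E| (4/δ)² · μ((A ∪ A')ᶜ) < μ(A) μ(A')` (`|E| = 4(2S+1)⁴`
links, `μ` Wilson's measure), then `SliceBottleneckAt G r`. The test function is
`bottleneckFun r A' δ = min(1, max(0, (4/δ) D_{A'} − 1))`, `D_{A'}` the `sliceDist`-distance to `A'`: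
gauge invariant (unitary invariance of the Frobenius norm), time-zero-local, `(4/δ)`-Lipschitz, `= 1`
on `A`, `= 0` on `A'`, with metric slopes in `[0, 4/δ]` vanishing off the layer
`{δ/4 ≤ D_{A'} ≤ δ/2} ⊆ (A ∪ A')ᶜ` (`limsup_slope_bottleneckFun_le`, `…_eq_zero`), whence
`dir f ≤ |E| (4/δ)² μ((A ∪ A')ᶜ)`, while `Var f ≥ μ(A) μ(A')` (`measureReal_mul_le_integral_sq_sub`).
So an inhabitant of `SliceBottleneck` is EXACTLY: the sector events and the two measure estimates.
-/

noncomputable section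

open scoped BigOperators Topology
open Filter MeasureTheory

namespace Literature.MathematicalPhysics.QuantumFieldTheory

/-- **Slice bottleneck at weak coupling for `(G, r)`** (vocabulary verbatim from the
`QuantumFields/YangMills` slice-Poincaré route items: `μ` Wilson's measure on `(2S+1)⁴`, `fro` the
squared Frobenius norm, `slope` the single-link metric slope, `dir` the time-zero spatial Dirichlet
form): for cofinally many `β`, every budget `K` and cofinally many `S` there is a gauge-invariant,
time-zero-local, link-Lipschitz `f` with `K (2S+1)³ · dir f < Var_μ f`. Expected to hold for
`G = SO(3)` and every faithful `r` via the 't Hooft magnetic-flux sectors of the spatial torus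
(module docstring); NOT asserted. [cite: tHooft1979Flux] [cite: DeforcrandJahn2003, §4 and §6]
[cite: ForcrandSmekal2002] -/
def SliceBottleneckAt (G : Type) [Group G] [TopologicalSpace G] [IsTopologicalGroup G]
    [CompactSpace G] [MeasurableSpace G] [BorelSpace G] (r : LatticeRep G) : Prop :=
  ∀ β₀ : ℝ, ∃ β : ℝ, β₀ ≤ β ∧ ∀ K : ℝ, ∀ S₀ : ℕ, ∃ S : ℕ, S₀ ≤ S ∧
    let μ := wilsonMeasure (d := 4) (L := 2 * S + 1) r.ρ β
    let fro : Matrix (Fin r.N) (Fin r.N) ℂ → ℝ := fun M => ∑ a, ∑ b, ‖M a b‖ ^ 2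
    let slope : (GaugeConfig 4 (2 * S + 1) G → ℝ) → GaugeConfig 4 (2 * S + 1) G →
        Edge 4 (2 * S + 1) → ℝ := fun f U e =>
      Filter.limsup (fun g : G => |f (Function.update U e g) - f U| /
        Real.sqrt (fro (r.ρ g - r.ρ (U e)))) (𝓝[≠] (U e))
    let dir : (GaugeConfig 4 (2 * S + 1) G → ℝ) → ℝ := fun f =>
      ∑ e : Edge 4 (2 * S + 1), (if e.1 0 = 0 ∧ e.2 ≠ 0 then ∫ U, (slope f U e) ^ 2 ∂μ else 0)
    ∃ f : GaugeConfig 4 (2 * S + 1) G → ℝ, IsGaugeInvariant f ∧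
      (∀ U V : GaugeConfig 4 (2 * S + 1) G,
        (∀ e : Edge 4 (2 * S + 1), e.1 0 = 0 → e.2 ≠ 0 → U e = V e) → f U = f V) ∧
      (∃ K' : ℝ, ∀ U V : GaugeConfig 4 (2 * S + 1) G,
        |f U - f V| ≤ K' * ∑ e, Real.sqrt (fro (r.ρ (U e) - r.ρ (V e)))) ∧
      K * (2 * S + 1 : ℝ) ^ 3 * dir f < ∫ U, (f U - ∫ V, f V ∂μ) ^ 2 ∂μ

/-- **A slice-bottleneck witness**: an admissible gauge group (`IsCompactSimpleLieGroup`) and a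
faithful unitary lattice representation carrying `SliceBottleneckAt` (intended `G = SO(3)`). [folklore] -/
structure SliceBottleneckWitness where
  /-- the gauge group -/
  G : Type
  [grp : Group G]
  [top : TopologicalSpace G]
  [topGrp : IsTopologicalGroup G]
  [cpt : CompactSpace G]
  [meas : MeasurableSpace G]
  [borel : BorelSpace G]
  /-- admissibility for the Yang–Mills statement -/
  simple : IsCompactSimpleLieGroup G
  /-- the faithful unitary lattice representation -/
  r : LatticeRep G
  /-- the bottleneck -/
  bottleneck : SliceBottleneckAt G r

/-- OPEN CONJECTURE — **the slice bottleneck exists for some admissible `(G, r)`**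
(`Nonempty SliceBottleneckWitness`). Expected true (`G = SO(3)`, light magnetic-flux sectors: module
docstring) but NOT asserted and not constructible in the tree today — it needs the lightness of
magnetic fluxes of `SO(3)` lattice gauge theory on large tori at weak coupling (physics: a sufficient
condition for confinement, supported numerically, proved nowhere — module docstring `## Status`) and
multi-scale Peierls bounds for the dilute `ℤ₂`-monopole gas of the slice; by
`sliceBottleneckAt_of_separatedSets` these two measure estimates on the sector events are exactly what
is missing. *Where posed / status.* A refuter's hypothesis bundle (negative lemma
`brascampLiebVacuum_false_of_sliceBottleneck`), registered open statement; deliberately no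
`SliceBottleneck_holds`; statement unchanged, name kept. [cite: DeforcrandJahn2003, §4 and §6]
[cite: Greensite2020Confinement, §4.4 eqs. (4.44)–(4.47), PDF p. 47] [status: open] -/
@[conjecture] def SliceBottleneck : Prop := Nonempty SliceBottleneckWitness

end Literature.MathematicalPhysics.QuantumFieldTheory

end
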